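import Literature.InformationTheory.QuantumCodes.HypergraphProductThresholds
import Literature.Probability.Percolation.SharpnessDCTProofs
import HarnessLib

/-!
# Planar-surface-code losses and square-lattice bond percolation, I: a lost pattern carrying an ODD rough-to-rough
# cycle joins a rough-boundary site to distance `k + 2` in the lifted percolation configuration

Topic `Literature/InformationTheory/QuantumCodes` (venture QEC, LADDER-QEC rung Q5 — towards the EXACT loss threshold
`y_c = 1/2` of the PLANAR surface codes; qec-type-03). All PROVED, no named fact, kernel axioms. The planar code is lit-2's
`HGP(H, Hᵀ)` (`HypergraphProductThresholds.lean`: `H = repMatrix (k+1)`, checks `planarHX k` on the vertices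
`Fin (k+1) × Fin (k+2)`; the "left" qubit `(α, b)` is the link between the vertices `(α - 1, b)` and `(α, b)` — a DANGLING
link of the rough boundary when `α = 0` or `α = k + 1` — and the "right" qubit `(a, β)` joins `(a, β)` and `(a, β + 1)`).
We lift a loss pattern `Er` to a bond configuration of `ℤ²` (`planarLift u Er`: vertex `(a, b) ↦ (a, b) + u`, the rough
boundaries becoming the rows `a = -1` and `a = k + 1`) and prove the combinatorial heart of Stace–Barrett–Doherty's
percolation picture for the planar code:

* **`exists_reachable_top_of_odd`** — if `x` is a cycle of the sector (`planarHX k *ᵥ x = 0`) supported in the lost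
  links and crossing the bottom rough boundary an ODD number of times (`Σ_b x(0, b) = 1`; every non-trivial logical of
  the sector does, `k = 1`), then in the lift some bottom rough site `(-1, b₀)` is joined by lost links to some top rough
  site `(k+1, b₁)` — a parity (hand-shaking) argument on the set of vertices reachable from the bottom row;
* **`exists_planarLift_mem_siteToBoundary`** — hence, centring the lift at `(-1, b₀)`, the one-arm event
  `{0 ↔ ∂B(k+1) in B(k+1)}` of `ℤ²` bond percolation occurs (the joined top site is at sup-distance `k + 2`).

The probabilistic half (domination by bond percolation; union bound; Kesten's theorem) is `PlanarCodeErasureHalf.lean`.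

## References

* [StaceBarrettDoherty2009] Stace–Barrett–Doherty, PRL 102 (2009) 200501, arXiv:0904.3556, p. 2–3 (loss recovery fails
  iff the losses percolate between the relevant boundaries; `p_loss < 0.5`).
* [DennisEtAl2002] Dennis–Kitaev–Landahl–Preskill, J. Math. Phys. 43 (2002) 4452, §3.2 (planar codes, rough edges).
* [TillichZemor2014] J.-P. Tillich, G. Zémor, IEEE Trans. IT 60 (2014) 1193, §3 (the surface code as `HGP(H, Hᵀ)`).
-/

namespace Literature.InformationTheory.QuantumCodes

namespace PlanarCode

open Finset Matrix
open Literature.Probability.LatticeModels (Site box zdGraph innerBoundary mem_box zero_mem_box zdGraph_adj_iff)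
open Literature.Probability.Percolation (BondConfig openGraph openGraph_adj siteToBoundary PathIn)

variable {k : ℕ}

/-! ### The lift of the planar patch to `ℤ²` -/

/-- The `ℤ²` site of the vertex with integer coordinates `(a, b)`, translated by `u`. [cite: DennisEtAl2002, §3.2 (the planar lattice)] -/
def pv (u : Site 2) (a b : ℤ) : Site 2 := ![a, b] + u

/-- Sites are determined by their coordinates. [folklore] -/
private theorem pv_inj {u : Site 2} {a b a' b' : ℤ} : pv u a b = pv u a' b' ↔ a = a' ∧ b = b' := by
  refine ⟨fun h => ?_, by rintro ⟨rfl, rfl⟩; rfl⟩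
  have h' : (![a, b] : Site 2) = ![a', b'] := add_right_cancel h
  exact ⟨by simpa using congrFun h' 0, by simpa using congrFun h' 1⟩

/-- Coordinates of a site. [folklore] -/
private theorem pv_apply_zero (u : Site 2) (a b : ℤ) : pv u a b 0 = a + u 0 := by simp [pv]

/-- Vertically consecutive sites are adjacent in `ℤ²`. [folklore] -/
private theorem zdGraph_adj_pv_left (u : Site 2) (a b : ℤ) : (zdGraph 2).Adj (pv u a b) (pv u (a + 1) b) := by
  rw [zdGraph_adj_iff]
  refine ⟨0, Or.inl ?_⟩
  funext j
  fin_cases j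
  · simp [pv, Matrix.vecHead, Matrix.vecTail]
    ring
  · simp [pv, Matrix.vecHead, Matrix.vecTail]

/-- Horizontally consecutive sites are adjacent in `ℤ²`. [folklore] -/
private theorem zdGraph_adj_pv_right (u : Site 2) (a b : ℤ) : (zdGraph 2).Adj (pv u a b) (pv u a (b + 1)) := by
  rw [zdGraph_adj_iff]
  refine ⟨1, Or.inl ?_⟩
  funext j
  fin_cases j
  · simp [pv, Matrix.vecHead, Matrix.vecTail]
  · simp [pv, Matrix.vecHead, Matrix.vecTail]
    ring

/-- **The `ℤ²` bond carried by a qubit of the planar code**: the left qubit `(α, b)` is the link `{(α-1, b), (α, b)}`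
(dangling below the patch for `α = 0`, above it for `α = k+1`), the right qubit `(a, β)` the link `{(a, β), (a, β+1)}`.
[cite: TillichZemor2014, §3 (the surface code HGP(H, Hᵀ): edges of type E_R and E_L)] -/
def qubitEdge (u : Site 2) : PlanarQubit k → Sym2 (Site 2) :=
  Sum.elim (fun αb => s(pv u (((αb.1 : ℕ) : ℤ) - 1) αb.2, pv u αb.1 αb.2))
    (fun aβ => s(pv u aβ.1 aβ.2, pv u aβ.1 (((aβ.2 : ℕ) : ℤ) + 1)))

/-- **The lift of a loss pattern** (translated by `u`): the bond configuration of `ℤ²` whose open bonds are the bonds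
carried by the lost qubits. [cite: StaceBarrettDoherty2009, p. 2 (lost qubits as bonds of the lattice)] -/
def planarLift (u : Site 2) (Er : Finset (PlanarQubit k)) : BondConfig (Site 2) := {e | ∃ q ∈ Er, qubitEdge u q = e}

/-- A lost left qubit opens its bond. [cite: StaceBarrettDoherty2009, p. 2] -/
theorem adj_of_inl_mem (u : Site 2) {Er : Finset (PlanarQubit k)} {α b : Fin (k + 2)}
    (h : (Sum.inl (α, b) : PlanarQubit k) ∈ Er) :
    (openGraph (planarLift u Er)).Adj (pv u (((α : ℕ) : ℤ) - 1) b) (pv u α b) := by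
  rw [openGraph_adj]
  refine ⟨⟨_, h, rfl⟩, fun heq => ?_⟩
  have := (pv_inj.1 heq).1
  omega

/-- A lost right qubit opens its bond. [cite: StaceBarrettDoherty2009, p. 2] -/
theorem adj_of_inr_mem (u : Site 2) {Er : Finset (PlanarQubit k)} {a : Fin (k + 1)} {β : Fin (k + 1)}
    (h : (Sum.inr (a, β) : PlanarQubit k) ∈ Er) :
    (openGraph (planarLift u Er)).Adj (pv u a β) (pv u a (((β : ℕ) : ℤ) + 1)) := by
  rw [openGraph_adj]
  refine ⟨⟨_, h, rfl⟩, fun heq => ?_⟩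
  have := (pv_inj.1 heq).2
  omega

/-- Every open bond of the lift is a bond of `ℤ²`. [folklore] -/
private theorem zdGraph_adj_of_adj (u : Site 2) {Er : Finset (PlanarQubit k)} {p p' : Site 2}
    (h : (openGraph (planarLift u Er)).Adj p p') : (zdGraph 2).Adj p p' := by
  rw [openGraph_adj] at h
  obtain ⟨⟨q, -, hq⟩, -⟩ := h
  rcases q with ⟨α, b⟩ | ⟨a, β⟩
  · simp only [qubitEdge, Sum.elim_inl, Sym2.eq_iff] at hq
    have hA := zdGraph_adj_pv_left u (((α : ℕ) : ℤ) - 1) b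
    rw [sub_add_cancel] at hA
    rcases hq with ⟨rfl, rfl⟩ | ⟨rfl, rfl⟩
    · exact hA
    · exact hA.symm
  · simp only [qubitEdge, Sum.elim_inr, Sym2.eq_iff] at hq
    have hA := zdGraph_adj_pv_right u a β
    rcases hq with ⟨rfl, rfl⟩ | ⟨rfl, rfl⟩
    · exact hA
    · exact hA.symm

/-! ### The vertices reachable from the bottom rough boundary -/

open Classical in
/-- The vertices `(a, b)` of the patch whose site is joined, through lost links, to SOME site `(-1, b₀)` of the bottom
rough row. [cite: StaceBarrettDoherty2009, p. 2 (percolated region of losses)] -/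
noncomputable def reach (u : Site 2) (Er : Finset (PlanarQubit k)) : Finset (Fin (k + 1) × Fin (k + 2)) :=
  univ.filter fun v => ∃ b₀ : Fin (k + 2), (openGraph (planarLift u Er)).Reachable (pv u (-1) b₀) (pv u v.1 v.2)

/-- Reachability from the bottom row is the same at the two ends of an open bond. [folklore] -/
private theorem reachable_iff_of_adj (u : Site 2) {Er : Finset (PlanarQubit k)} {p p' : Site 2}
    (h : (openGraph (planarLift u Er)).Adj p p') :
    (∃ b₀ : Fin (k + 2), (openGraph (planarLift u Er)).Reachable (pv u (-1) b₀) p) ↔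
      ∃ b₀ : Fin (k + 2), (openGraph (planarLift u Er)).Reachable (pv u (-1) b₀) p' :=
  ⟨fun ⟨b₀, hb⟩ => ⟨b₀, hb.trans h.reachable⟩, fun ⟨b₀, hb⟩ => ⟨b₀, hb.trans h.symm.reachable⟩⟩

/-- A lost bottom dangling link `(0, b)` puts the vertex `(0, b)` in `reach`. [cite: StaceBarrettDoherty2009, p. 2] -/
theorem mem_reach_bottom (u : Site 2) {Er : Finset (PlanarQubit k)} {b : Fin (k + 2)}
    (h : (Sum.inl (0, b) : PlanarQubit k) ∈ Er) : ((0 : Fin (k + 1)), b) ∈ reach u Er := by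
  classical
  rw [reach, Finset.mem_filter]
  refine ⟨Finset.mem_univ _, b, ?_⟩
  have hA := adj_of_inl_mem u h
  simp only [Fin.val_zero, Nat.cast_zero, zero_sub] at hA
  exact hA.reachable

/-- Membership in `reach` in terms of the site. [folklore] -/
private theorem mem_reach_iff (u : Site 2) (Er : Finset (PlanarQubit k)) (v : Fin (k + 1) × Fin (k + 2)) :
    v ∈ reach u Er ↔ ∃ b₀ : Fin (k + 2), (openGraph (planarLift u Er)).Reachable (pv u (-1) b₀) (pv u v.1 v.2) := by
  classical
  simp [reach]

/-! ### The vertex syndrome as a sum over incident links -/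

/-- **The vertex syndrome of the planar code** at `(a, b)`: left links through the repetition checks, right links
through the transposed checks. [cite: TillichZemor2014, §3 (vertex–edge incidences of HGP(H, Hᵀ))] -/
theorem planarHX_mulVec_eq_sum (x : PlanarQubit k → ZMod 2) (a : Fin (k + 1)) (b : Fin (k + 2)) :
    (planarHX k *ᵥ x) (a, b) =
      (∑ α : Fin (k + 2), repMatrix (k + 1) a α * x (Sum.inl (α, b))) +
        ∑ β : Fin (k + 1), repMatrix (k + 1) β b * x (Sum.inr (a, β)) := by
  classical
  simp only [planarHX, mulVec, dotProduct, Fintype.sum_sum_type, Fintype.sum_prod_type,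
    HypergraphProduct.xMatrix_apply_inl, HypergraphProduct.xMatrix_apply_inr, Matrix.transpose_apply]
  congr 1
  · refine Finset.sum_congr rfl fun α _ => ?_
    rw [Finset.sum_eq_single b]
    · simp
    · intro b' _ hb'
      simp [Ne.symm hb']
    · intro h; exact absurd (Finset.mem_univ _) h
  · rw [Finset.sum_eq_single a]
    · simp
    · intro a' _ ha'
      refine Finset.sum_eq_zero fun β _ => ?_
      simp [Ne.symm ha']
    · intro h; exact absurd (Finset.mem_univ _) h

/-- The repetition entry in `ℤ₂` as a sum of the two point indicators: `[j = i.cs ∨ j = i.succ] = [j = i.cs] + [j = i.succ]`.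
[cite: TillichZemor2014, §3 (repetition code)] -/
theorem repMatrix_apply_eq_add (n : ℕ) (i : Fin n) (j : Fin (n + 1)) :
    repMatrix n i j = (if j = i.castSucc then 1 else 0) + (if j = i.succ then 1 else 0) := by
  have hne : i.castSucc ≠ i.succ := (Fin.castSucc_lt_succ (i := i)).ne
  simp only [repMatrix, Matrix.of_apply]
  by_cases h1 : j = i.castSucc
  · subst h1
    simp [hne]
  · by_cases h2 : j = i.succ <;> simp [h1, h2, hne.symm]

/-! ### The parity argument: an odd bottom crossing reaches the top -/

/-- The reach indicator is the same at two vertices joined by an open bond of the lift. [folklore] -/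
private theorem mem_reach_iff_of_adj (u : Site 2) {Er : Finset (PlanarQubit k)} {v w : Fin (k + 1) × Fin (k + 2)}
    (h : (openGraph (planarLift u Er)).Adj (pv u v.1 v.2) (pv u w.1 w.2)) : v ∈ reach u Er ↔ w ∈ reach u Er := by
  rw [mem_reach_iff, mem_reach_iff]
  exact reachable_iff_of_adj u h

/-- **An odd bottom crossing reaches the top rough boundary.** Let `x` be a cycle of the sector (`H_X x = 0`) supported
in the lost links and crossing the bottom rough boundary an odd number of times (`Σ_b x(0,b)_L = 1`). Then some bottom
rough site `(-1, b₀)` is joined through lost links to some top rough site `(k+1, b₁)` (hand-shaking over the vertices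
reachable from the bottom row: interior lost links contribute `0` or `2`, bottom dangling ones `1`).
[cite: StaceBarrettDoherty2009, p. 2–3 (recovery fails iff the losses percolate)] -/
theorem exists_reachable_top_of_odd (u : Site 2) {Er : Finset (PlanarQubit k)} {x : PlanarQubit k → ZMod 2}
    (hx : planarHX k *ᵥ x = 0) (hxE : ∀ q, x q ≠ 0 → q ∈ Er)
    (hodd : ∑ b : Fin (k + 2), x (Sum.inl (0, b)) = 1) :
    ∃ b₀ b₁ : Fin (k + 2), (openGraph (planarLift u Er)).Reachable (pv u (-1) b₀) (pv u ((k : ℤ) + 1) b₁) := by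
  classical
  set χ : Fin (k + 1) × Fin (k + 2) → ZMod 2 := fun v => if v ∈ reach u Er then 1 else 0 with hχ
  have hχeq : ∀ {v w : Fin (k + 1) × Fin (k + 2)},
      (openGraph (planarLift u Er)).Adj (pv u v.1 v.2) (pv u w.1 w.2) → χ v = χ w := by
    intro v w h
    simp only [hχ, mem_reach_iff_of_adj u h]
  have hzz : ∀ t : ZMod 2, t + t = 0 := by decide
  -- (1) the total syndrome over `R` vanishes
  have h1 : ∑ a : Fin (k + 1), ∑ b : Fin (k + 2), χ (a, b) * (planarHX k *ᵥ x) (a, b) = 0 := by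
    refine Finset.sum_eq_zero fun a _ => Finset.sum_eq_zero fun b _ => ?_
    rw [hx, Pi.zero_apply, mul_zero]
  -- (2) expand the syndrome: left links via the repetition checks, right links via the transposed checks
  have hleft : ∀ (a : Fin (k + 1)) (b : Fin (k + 2)),
      ∑ α : Fin (k + 2), repMatrix (k + 1) a α * x (Sum.inl (α, b)) =
        x (Sum.inl (a.castSucc, b)) + x (Sum.inl (a.succ, b)) := by
    intro a b
    have := repMatrix_mulVec_apply (k + 1) (fun α => x (Sum.inl (α, b))) a
    simpa [Matrix.mulVec, dotProduct] using this
  -- (3) the right links contribute nothing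
  have hright : ∀ (a : Fin (k + 1)),
      ∑ b : Fin (k + 2), χ (a, b) * ∑ β : Fin (k + 1), repMatrix (k + 1) β b * x (Sum.inr (a, β)) = 0 := by
    intro a
    have hswap : ∑ b : Fin (k + 2), χ (a, b) * ∑ β : Fin (k + 1), repMatrix (k + 1) β b * x (Sum.inr (a, β)) =
        ∑ β : Fin (k + 1), x (Sum.inr (a, β)) * ∑ b : Fin (k + 2), repMatrix (k + 1) β b * χ (a, b) := by
      simp_rw [Finset.mul_sum]
      rw [Finset.sum_comm]
      refine Finset.sum_congr rfl fun β _ => Finset.sum_congr rfl fun b _ => ?_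
      ring
    rw [hswap]
    refine Finset.sum_eq_zero fun β _ => ?_
    have hinner : ∑ b : Fin (k + 2), repMatrix (k + 1) β b * χ (a, b) = χ (a, β.castSucc) + χ (a, β.succ) := by
      simp_rw [repMatrix_apply_eq_add, add_mul, Finset.sum_add_distrib, ite_mul, one_mul, zero_mul,
        Finset.sum_ite_eq', Finset.mem_univ, if_true]
    rw [hinner]
    by_cases hq : x (Sum.inr (a, β)) = 0
    · rw [hq, zero_mul]
    · have hadj := adj_of_inr_mem u (hxE _ hq)
      have e : χ (a, β.castSucc) = χ (a, β.succ) := by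
        refine hχeq ?_
        simpa [Fin.val_succ] using hadj
      rw [e, hzz, mul_zero]
  -- (4) the left links: interior ones cancel, bottom ones count `1`, top ones count `[vertex ∈ R]`
  have hmid : ∀ (i : Fin k) (b : Fin (k + 2)),
      (χ (i.succ, b) + χ (i.castSucc, b)) * x (Sum.inl (i.castSucc.succ, b)) = 0 := by
    intro i b
    by_cases hq : x (Sum.inl (i.castSucc.succ, b)) = 0
    · rw [hq, mul_zero]
    · have hadj := adj_of_inl_mem u (hxE _ hq)
      have e : χ (i.castSucc, b) = χ (i.succ, b) := by
        refine hχeq ?_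
        simpa [Fin.val_succ] using hadj
      rw [e, hzz, zero_mul]
  have hbot : ∀ b : Fin (k + 2), χ (0, b) * x (Sum.inl (0, b)) = x (Sum.inl (0, b)) := by
    intro b
    by_cases hq : x (Sum.inl (0, b)) = 0
    · rw [hq, mul_zero]
    · have hmem := mem_reach_bottom u (hxE _ hq)
      simp [hχ, hmem]
  have hcol : ∀ b : Fin (k + 2),
      ∑ a : Fin (k + 1), χ (a, b) * (x (Sum.inl (a.castSucc, b)) + x (Sum.inl (a.succ, b))) =
        x (Sum.inl (0, b)) + χ (Fin.last k, b) * x (Sum.inl (Fin.last (k + 1), b)) := by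
    intro b
    simp_rw [mul_add, Finset.sum_add_distrib]
    rw [Fin.sum_univ_succ, Fin.sum_univ_castSucc (fun a => χ (a, b) * x (Sum.inl (a.succ, b))), Fin.castSucc_zero,
      hbot, Fin.succ_last]
    have hpair : ∑ i : Fin k, χ (i.succ, b) * x (Sum.inl (i.succ.castSucc, b)) +
        ∑ i : Fin k, χ (i.castSucc, b) * x (Sum.inl (i.castSucc.succ, b)) = 0 := by
      rw [← Finset.sum_add_distrib]
      refine Finset.sum_eq_zero fun i _ => ?_
      rw [← Fin.succ_castSucc, ← add_mul]
      exact hmid i b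
    calc x (Sum.inl (0, b)) + ∑ i : Fin k, χ (i.succ, b) * x (Sum.inl (i.succ.castSucc, b)) +
          (∑ i : Fin k, χ (i.castSucc, b) * x (Sum.inl (i.castSucc.succ, b)) +
            χ (Fin.last k, b) * x (Sum.inl (Fin.last (k + 1), b)))
        = x (Sum.inl (0, b)) + χ (Fin.last k, b) * x (Sum.inl (Fin.last (k + 1), b)) +
            (∑ i : Fin k, χ (i.succ, b) * x (Sum.inl (i.succ.castSucc, b)) +
              ∑ i : Fin k, χ (i.castSucc, b) * x (Sum.inl (i.castSucc.succ, b))) := by ring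
      _ = _ := by rw [hpair, add_zero]
  -- (5) assemble: `0 = 1 + Σ_b χ(k, b) x(k+1, b)`
  have htot : ∑ b : Fin (k + 2), χ (Fin.last k, b) * x (Sum.inl (Fin.last (k + 1), b)) = 1 := by
    have h2 : ∑ a : Fin (k + 1), ∑ b : Fin (k + 2), χ (a, b) * (planarHX k *ᵥ x) (a, b) =
        ∑ b : Fin (k + 2), x (Sum.inl (0, b)) +
          ∑ b : Fin (k + 2), χ (Fin.last k, b) * x (Sum.inl (Fin.last (k + 1), b)) := by
      simp_rw [planarHX_mulVec_eq_sum, mul_add, Finset.sum_add_distrib, hright, Finset.sum_const_zero, add_zero,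
        hleft]
      rw [Finset.sum_comm, ← Finset.sum_add_distrib]
      exact Finset.sum_congr rfl fun b _ => hcol b
    rw [h1, hodd] at h2
    have key : ∀ t : ZMod 2, 0 = 1 + t → t = 1 := by decide
    exact key _ h2
  -- (6) a top dangling lost link whose vertex is reachable
  obtain ⟨b₁, -, hb₁⟩ := Finset.exists_ne_zero_of_sum_ne_zero (by rw [htot]; exact one_ne_zero)
  have hχ1 : χ (Fin.last k, b₁) ≠ 0 := fun h => hb₁ (by rw [h, zero_mul])
  have hx1 : x (Sum.inl (Fin.last (k + 1), b₁)) ≠ 0 := fun h => hb₁ (by rw [h, mul_zero])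
  have hmem : (Fin.last k, b₁) ∈ reach u Er := by
    by_contra h
    exact hχ1 (by simp [hχ, h])
  obtain ⟨b₀, hb₀⟩ := (mem_reach_iff u Er _).1 hmem
  have hadj := adj_of_inl_mem u (hxE _ hx1)
  refine ⟨b₀, b₁, hb₀.trans ?_⟩
  have e1 : (((Fin.last (k + 1) : Fin (k + 2)) : ℕ) : ℤ) - 1 = ((Fin.last k : Fin (k + 1)) : ℕ) := by
    simp
  have e2 : (((Fin.last (k + 1) : Fin (k + 2)) : ℕ) : ℤ) = (k : ℤ) + 1 := by
    simp
  rw [e1, e2] at hadj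
  exact hadj.reachable

/-! ### The one-arm event -/

/-- A path of a subgraph of `ℤ²` from inside the box `B(n)` to outside it reaches `∂B(n)` inside `B(n)`. [folklore] -/
private theorem exists_pathIn_innerBoundary {G : SimpleGraph (Site 2)} (hG : ∀ p q, G.Adj p q → (zdGraph 2).Adj p q)
    {n : ℕ} {p q : Site 2} (hp : p ∈ box 2 n) (hq : q ∉ box 2 n) (h : G.Reachable p q) :
    ∃ w ∈ innerBoundary (zdGraph 2) (box 2 n), PathIn G ↑(box 2 n) p w := by
  classical
  rw [SimpleGraph.reachable_iff_reflTransGen] at h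
  have key : ∀ r, Relation.ReflTransGen G.Adj p r →
      PathIn G ↑(box 2 n) p r ∨ ∃ w ∈ innerBoundary (zdGraph 2) (box 2 n), PathIn G ↑(box 2 n) p w := by
    intro r hr
    induction hr with
    | refl => exact Or.inl (PathIn.refl (Finset.mem_coe.2 hp))
    | @tail b c _ hbc ih =>
      rcases ih with hpb | hdone
      · by_cases hc : c ∈ box 2 n
        · exact Or.inl (hpb.tail hbc (Finset.mem_coe.2 hc))
        · refine Or.inr ⟨b, ?_, hpb⟩
          rw [Literature.Probability.LatticeModels.mem_innerBoundary_iff]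
          exact ⟨Finset.mem_coe.1 hpb.right_mem, c, hc, hG _ _ hbc⟩
      · exact Or.inr hdone
  rcases key q h with hpq | hdone
  · exact absurd (Finset.mem_coe.1 hpq.right_mem) hq
  · exact hdone

/-- Translating the lift: `pv u' a b = pv u a b + (u' - u)`. [folklore] -/
private theorem pv_translate (u u' : Site 2) (a b : ℤ) : pv u' a b = pv u a b + (u' - u) := by
  unfold pv; abel

/-- Translating the lift: the bond of a qubit moves with the translation. [folklore] -/
private theorem qubitEdge_translate (u u' : Site 2) (q : PlanarQubit k) :
    qubitEdge u' q = (qubitEdge u q).map (· + (u' - u)) := by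
  rcases q with ⟨α, b⟩ | ⟨a, β⟩
  · simp only [qubitEdge, Sum.elim_inl, Sym2.map_mk, ← pv_translate]
  · simp only [qubitEdge, Sum.elim_inr, Sym2.map_mk, ← pv_translate]

/-- Translating the lift preserves adjacency. [folklore] -/
private theorem adj_translate (u u' : Site 2) {Er : Finset (PlanarQubit k)} {p q : Site 2}
    (h : (openGraph (planarLift u Er)).Adj p q) :
    (openGraph (planarLift u' Er)).Adj (p + (u' - u)) (q + (u' - u)) := by
  rw [openGraph_adj] at h ⊢
  obtain ⟨⟨q₀, hq₀, he⟩, hne⟩ := h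
  refine ⟨⟨q₀, hq₀, ?_⟩, fun heq => hne (add_right_cancel heq)⟩
  rw [qubitEdge_translate u u', he, Sym2.map_mk]

/-- Translating the lift preserves reachability. [folklore] -/
private theorem reachable_translate (u u' : Site 2) {Er : Finset (PlanarQubit k)} {p q : Site 2}
    (h : (openGraph (planarLift u Er)).Reachable p q) :
    (openGraph (planarLift u' Er)).Reachable (p + (u' - u)) (q + (u' - u)) := by
  rw [SimpleGraph.reachable_iff_reflTransGen] at h ⊢
  induction h with
  | refl => exact Relation.ReflTransGen.refl
  | tail _ hbc ih => exact ih.tail (adj_translate u u' hbc)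

/-- **An odd rough-to-rough cycle in the lost links produces a one-arm event**: centring the lift at the bottom rough
site `(-1, b₀)` from which the top is reached gives `{0 ↔ ∂B(k+1) in B(k+1)}` (the top row is at sup-distance `k + 2`).
[cite: StaceBarrettDoherty2009, p. 2–3 (percolated region of losses between the boundaries)] -/
theorem exists_planarLift_mem_siteToBoundary {Er : Finset (PlanarQubit k)} {x : PlanarQubit k → ZMod 2}
    (hx : planarHX k *ᵥ x = 0) (hxE : ∀ q, x q ≠ 0 → q ∈ Er) (hodd : ∑ b : Fin (k + 2), x (Sum.inl (0, b)) = 1) :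
    ∃ b₀ : Fin (k + 2), planarLift (-![(-1 : ℤ), ((b₀ : ℕ) : ℤ)]) Er ∈ siteToBoundary 2 (k + 1) := by
  classical
  obtain ⟨b₀, b₁, hreach₀⟩ := exists_reachable_top_of_odd (0 : Site 2) hx hxE hodd
  set u : Site 2 := -![(-1 : ℤ), ((b₀ : ℕ) : ℤ)] with hu
  have hreach := reachable_translate 0 u hreach₀
  rw [← pv_translate, ← pv_translate] at hreach
  refine ⟨b₀, ?_⟩
  have h0 : pv u (-1) ((b₀ : ℕ) : ℤ) = 0 := by
    funext j; fin_cases j <;> simp [pv, hu]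
  have hout : pv u ((k : ℤ) + 1) ((b₁ : ℕ) : ℤ) ∉ box 2 (k + 1) := by
    rw [mem_box, not_forall]
    refine ⟨0, ?_⟩
    simp only [pv_apply_zero, hu, Pi.neg_apply, Matrix.cons_val_zero]
    push_cast
    omega
  rw [h0] at hreach
  obtain ⟨w, hw, hpath⟩ := exists_pathIn_innerBoundary (fun p q h => zdGraph_adj_of_adj u h) (zero_mem_box 2 (k + 1))
    hout hreach
  rw [Literature.Probability.Percolation.DCT16.mem_siteToBoundary_iff]
  exact ⟨w, hw, hpath⟩

end PlanarCode

end Literature.InformationTheory.QuantumCodes
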